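import Summits.HubbardSuperconductivity.HubbardSuperconductivity.Theorems.SoloBlindPairFieldLocality
import Summits.HubbardSuperconductivity.HubbardSuperconductivity.Theorems.SoloBlindPairTower
import HarnessLib

/-!
# Hereditary order along the pair tower

Obstruction report (solo-blind), Theorem 31; complements Theorem 11 (`SoloBlindPairTower`,
`SoloBlindPairTowerBound`: the ENERGIES of the tower states `Δψ`, `Δᴴψ`).

For any matrix `X` and vector `ψ`, two Cauchy–Schwarz steps and the commutator give

* `‖X(Xψ)‖² · ‖ψ‖² ≥ (‖Xψ‖²)² − ‖[X, Xᴴ]‖ · ‖Xψ‖² · ‖ψ‖²`   (`order_descends`),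
* `‖X(Xᴴψ)‖² · ‖ψ‖² ≥ (‖Xᴴψ‖²)²` and `‖Xᴴψ‖² ≥ ‖Xψ‖² − ‖[X,Xᴴ]‖ ‖ψ‖²`   (`order_ascends`,
  `re_self_conjTranspose_ge`),

i.e. in Rayleigh-quotient form: if the unit vector `ψ` has "order" `a = ‖Xψ‖²`, then the
normalised tower states `Xψ/‖Xψ‖` and `Xᴴψ/‖Xᴴψ‖` have order `≥ a − ‖[X,Xᴴ]‖`. Iterating
(`order_descends_iterate`): the `j`-th descending tower state has order `≥ a − j‖[X,Xᴴ]‖`.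

For the pair field `X = Δ_g = pairField g L` of the summit (`|g| ≤ 1`, e.g. `g = dWaveFormFactor`)
the landed locality bound `‖[Δ_g, Δ_gᴴ]‖ ≤ 800 L²`
(`PairTower.norm_commutator_pairField_conjTranspose_le`) makes the loss `O(L²)` per step against
an order of size `L⁴`: **a single state with d-wave order `a` in the sector `(N, M)` generates a
whole tower `Δ_g^j ψ ∈ (N − 2j, M)` of states with order `≥ a − 800 j L²`**
(`pairField_tower_mem_szSector`, `pairField_tower_order`). Together with Theorem 11 (the tower
states built on a sector GROUND state lie within the pair gap / pair chemical potential of the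
neighbouring sector ground energies) this is the finite-volume, fixed-`N` shadow of the
`U(1)`-broken condensate: order AND near-ground energy propagate along `N ↦ N ∓ 2j`.

Role in the obstruction map (census row r39, generation 19): what does NOT propagate is order of
the GROUND states of the neighbouring sectors — converting an ordered near-ground state into
order of every (or any) ground state is exactly the rigidity that Theorem 2
(`dWave_order_not_energy_robust`) shows to be unavailable from energies, and the excess energy of
`Δ^jψ` over `E₀(N − 2j)` is controlled only up to the concavity defect of `N ↦ E₀(N)`. Hence even
the OPENNESS in the doping `δ` of the set where the summit's conclusion holds ("a dome is
automatic") is not derivable by soft means; it is summit-hard at the same juncture (J3/J4 of §8).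

References: Cauchy–Schwarz; Koma–Tasaki, J. Stat. Phys. 76 (1994) 745 (tower states);
Scalapino, Phys. Rep. 250 (1995) 329, §2 (the pair field). Tags: [folklore] for the linear
algebra, [this work] for the tower-order statements.
-/

namespace Summit.HubbardSuperconductivity.HubbardSuperconductivity.Theorems

open Matrix Finset Literature.MathematicalPhysics.QuantumLattice HubbardWave0 GaugeTwist
open scoped ComplexConjugate ComplexOrder Matrix.Norms.L2Operator

namespace TowerOrder

/-! ### Abstract linear algebra -/

section Abstract

variable {n : Type*} [Fintype n] [DecidableEq n]

omit [DecidableEq n] in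
/-- `0 ≤ re ⟨v, v⟩`. [folklore] -/
private theorem re_star_dotProduct_self_nonneg (v : n → ℂ) : 0 ≤ (star v ⬝ᵥ v).re := by
  rw [← ThermodynamicLimit.norm_toLp_sq]; positivity

omit [DecidableEq n] in
/-- Cauchy–Schwarz: `(re ⟨a, b⟩)² ≤ re⟨a,a⟩ · re⟨b,b⟩`. [folklore] -/
private theorem re_star_dotProduct_sq_le (a b : n → ℂ) :
    (star a ⬝ᵥ b).re ^ 2 ≤ (star a ⬝ᵥ a).re * (star b ⬝ᵥ b).re := by
  rw [← ThermodynamicLimit.norm_toLp_sq a, ← ThermodynamicLimit.norm_toLp_sq b,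
    ThermodynamicLimit.star_dotProduct_eq_inner]
  have h := norm_inner_le_norm (𝕜 := ℂ) (WithLp.toLp 2 a : EuclideanSpace ℂ n)
    (WithLp.toLp 2 b : EuclideanSpace ℂ n)
  have hre := Complex.abs_re_le_norm
    (inner ℂ (WithLp.toLp 2 a : EuclideanSpace ℂ n) (WithLp.toLp 2 b : EuclideanSpace ℂ n))
  have hab := hre.trans h
  have h2 := pow_le_pow_left₀ (abs_nonneg _) hab 2
  rw [sq_abs, mul_pow] at h2
  exact h2

/-- **Order descends along the tower.** For any `X`, `ψ`:
`(‖Xψ‖²)² − ‖[X,Xᴴ]‖ ‖Xψ‖² ‖ψ‖² ≤ ‖X(Xψ)‖² ‖ψ‖²`; for a unit `ψ` with `‖Xψ‖² = a > 0` the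
normalised state `Xψ/‖Xψ‖` has `‖X(·)‖² ≥ a − ‖[X,Xᴴ]‖`. Proof: `‖X Xψ‖² = ‖XᴴXψ‖² −
re⟨Xψ,[X,Xᴴ]Xψ⟩` and `‖XᴴXψ‖²‖ψ‖² ≥ ⟨ψ,XᴴXψ⟩² = (‖Xψ‖²)²`. [this work] -/
theorem order_descends (X : Matrix n n ℂ) (ψ : n → ℂ) :
    (star (X *ᵥ ψ) ⬝ᵥ (X *ᵥ ψ)).re ^ 2
        - ‖X * Xᴴ - Xᴴ * X‖ * ((star (X *ᵥ ψ) ⬝ᵥ (X *ᵥ ψ)).re * (star ψ ⬝ᵥ ψ).re)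
      ≤ (star (X *ᵥ (X *ᵥ ψ)) ⬝ᵥ (X *ᵥ (X *ᵥ ψ))).re * (star ψ ⬝ᵥ ψ).re := by
  -- (1) ‖Xᴴφ‖² − ‖Xφ‖² = re⟨φ,[X,Xᴴ]φ⟩ for φ = Xψ
  have h1 := PairTower.re_self_conjTranspose_sub X (X *ᵥ ψ)
  -- (2) re⟨φ,[X,Xᴴ]φ⟩ ≤ ‖[X,Xᴴ]‖ ‖φ‖²
  have h2 : (star (X *ᵥ ψ) ⬝ᵥ (X * Xᴴ - Xᴴ * X) *ᵥ (X *ᵥ ψ)).re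
      ≤ ‖X * Xᴴ - Xᴴ * X‖ * (star (X *ᵥ ψ) ⬝ᵥ (X *ᵥ ψ)).re := by
    have := PairTower.abs_re_expect_le_norm_mul (X * Xᴴ - Xᴴ * X) (X *ᵥ ψ)
    rw [ThermodynamicLimit.norm_toLp_sq] at this
    exact (le_abs_self _).trans this
  -- (3) Cauchy–Schwarz for ⟨ψ, (XᴴX)ψ⟩ = ‖Xψ‖², and Xᴴ(Xψ) = (XᴴX)ψ
  have h3a : Xᴴ *ᵥ (X *ᵥ ψ) = (Xᴴ * X) *ᵥ ψ := mulVec_mulVec _ _ _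
  have h3b : star ψ ⬝ᵥ (Xᴴ * X) *ᵥ ψ = star (X *ᵥ ψ) ⬝ᵥ (X *ᵥ ψ) := by
    rw [star_mulVec, ← dotProduct_mulVec, mulVec_mulVec]
  have h3 := re_star_dotProduct_sq_le ψ ((Xᴴ * X) *ᵥ ψ)
  rw [h3b, ← h3a] at h3
  have hψ0 := re_star_dotProduct_self_nonneg ψ
  have h2s := mul_le_mul_of_nonneg_right h2 hψ0
  nlinarith [h1, h2s, h3]

omit [DecidableEq n] in
/-- `‖Xᴴψ‖² ≥ ‖Xψ‖² − ‖[X,Xᴴ]‖ ‖ψ‖²`. [folklore] -/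
theorem re_self_conjTranspose_ge [DecidableEq n] (X : Matrix n n ℂ) (ψ : n → ℂ) :
    (star (X *ᵥ ψ) ⬝ᵥ (X *ᵥ ψ)).re - ‖X * Xᴴ - Xᴴ * X‖ * (star ψ ⬝ᵥ ψ).re
      ≤ (star (Xᴴ *ᵥ ψ) ⬝ᵥ (Xᴴ *ᵥ ψ)).re := by
  have h1 := PairTower.re_self_conjTranspose_sub X ψ
  have h2 : -(star ψ ⬝ᵥ (X * Xᴴ - Xᴴ * X) *ᵥ ψ).re ≤ ‖X * Xᴴ - Xᴴ * X‖ * (star ψ ⬝ᵥ ψ).re := by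
    have := PairTower.abs_re_expect_le_norm_mul (X * Xᴴ - Xᴴ * X) ψ
    rw [ThermodynamicLimit.norm_toLp_sq] at this
    exact (neg_le_abs _).trans this
  linarith

omit [DecidableEq n] in
/-- **Order ascends along the tower.** `(‖Xᴴψ‖²)² ≤ ‖X(Xᴴψ)‖² ‖ψ‖²` (Cauchy–Schwarz for
`⟨ψ, XXᴴψ⟩`); with `re_self_conjTranspose_ge`, the normalised state `Xᴴψ/‖Xᴴψ‖` has
`‖X(·)‖² ≥ ‖Xᴴψ‖²/‖ψ‖² ≥ ‖Xψ‖²/‖ψ‖² − ‖[X,Xᴴ]‖`. [this work] -/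
theorem order_ascends (X : Matrix n n ℂ) (ψ : n → ℂ) :
    (star (Xᴴ *ᵥ ψ) ⬝ᵥ (Xᴴ *ᵥ ψ)).re ^ 2
      ≤ (star (X *ᵥ (Xᴴ *ᵥ ψ)) ⬝ᵥ (X *ᵥ (Xᴴ *ᵥ ψ))).re * (star ψ ⬝ᵥ ψ).re := by
  have ha : X *ᵥ (Xᴴ *ᵥ ψ) = (X * Xᴴ) *ᵥ ψ := mulVec_mulVec _ _ _
  have hb : star ψ ⬝ᵥ (X * Xᴴ) *ᵥ ψ = star (Xᴴ *ᵥ ψ) ⬝ᵥ (Xᴴ *ᵥ ψ) := by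
    rw [star_mulVec, conjTranspose_conjTranspose, ← dotProduct_mulVec, mulVec_mulVec]
  have h := re_star_dotProduct_sq_le ψ ((X * Xᴴ) *ᵥ ψ)
  rw [hb, ← ha] at h
  rw [mul_comm]
  exact h

/-- **Iterated descent.** If `‖[X,Xᴴ]‖ ≤ K` and `a ‖ψ‖² ≤ ‖Xψ‖²`, then for every `j` the `j`-th
tower state `ψ_j = X^j ψ` satisfies `(a − jK) ‖ψ_j‖² ≤ ‖X ψ_j‖²`: each normalised tower state
has order at least `a − jK`. [this work] -/
theorem order_descends_iterate (X : Matrix n n ℂ) (ψ : n → ℂ) {K a : ℝ}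
    (hK : ‖X * Xᴴ - Xᴴ * X‖ ≤ K) (h0 : a * (star ψ ⬝ᵥ ψ).re ≤ (star (X *ᵥ ψ) ⬝ᵥ (X *ᵥ ψ)).re)
    (j : ℕ) :
    (a - j * K) * (star ((X.mulVec)^[j] ψ) ⬝ᵥ ((X.mulVec)^[j] ψ)).re
      ≤ (star (X *ᵥ (X.mulVec)^[j] ψ) ⬝ᵥ (X *ᵥ (X.mulVec)^[j] ψ)).re := by
  induction j with
  | zero => simpa using h0
  | succ j ih =>
    set φ : n → ℂ := (X.mulVec)^[j] ψ with hφ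
    have hiter : (X.mulVec)^[j + 1] ψ = X *ᵥ φ := by
      rw [Function.iterate_succ_apply', hφ]
    rw [hiter]
    have hd := order_descends X φ
    have hs0 := re_star_dotProduct_self_nonneg φ
    have ha0 := re_star_dotProduct_self_nonneg (X *ᵥ φ)
    have hb0 := re_star_dotProduct_self_nonneg (X *ᵥ (X *ᵥ φ))
    have hN0 : 0 ≤ ‖X * Xᴴ - Xᴴ * X‖ := norm_nonneg _
    -- ‖Xφ‖² ≤ ‖XᴴX‖ ‖φ‖² (to dispose of the case ‖φ‖ = 0)
    have hbound : (star (X *ᵥ φ) ⬝ᵥ (X *ᵥ φ)).re ≤ ‖Xᴴ * X‖ * (star φ ⬝ᵥ φ).re := by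
      have h3b : star φ ⬝ᵥ (Xᴴ * X) *ᵥ φ = star (X *ᵥ φ) ⬝ᵥ (X *ᵥ φ) := by
        rw [star_mulVec, ← dotProduct_mulVec, mulVec_mulVec]
      have := PairTower.abs_re_expect_le_norm_mul (Xᴴ * X) φ
      rw [ThermodynamicLimit.norm_toLp_sq, h3b] at this
      exact (le_abs_self _).trans this
    push_cast
    rcases eq_or_lt_of_le hs0 with hs | hs
    · -- ‖φ‖² = 0 ⇒ ‖Xφ‖² = 0
      have ha : (star (X *ᵥ φ) ⬝ᵥ (X *ᵥ φ)).re = 0 := by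
        have := hbound; rw [← hs, mul_zero] at this; linarith
      rw [ha, mul_zero]; exact hb0
    · -- ‖φ‖² > 0: combine the induction hypothesis with `order_descends`
      have hKs : ‖X * Xᴴ - Xᴴ * X‖ * ((star (X *ᵥ φ) ⬝ᵥ (X *ᵥ φ)).re * (star φ ⬝ᵥ φ).re)
          ≤ K * ((star (X *ᵥ φ) ⬝ᵥ (X *ᵥ φ)).re * (star φ ⬝ᵥ φ).re) :=
        mul_le_mul_of_nonneg_right hK (mul_nonneg ha0 hs0)
      have hih := mul_le_mul_of_nonneg_left ih ha0
      -- target × ‖φ‖² then cancel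
      have key : ((a - (j + 1) * K) * (star (X *ᵥ φ) ⬝ᵥ (X *ᵥ φ)).re) * (star φ ⬝ᵥ φ).re
          ≤ (star (X *ᵥ (X *ᵥ φ)) ⬝ᵥ (X *ᵥ (X *ᵥ φ))).re * (star φ ⬝ᵥ φ).re := by
        nlinarith [hd, hKs, hih]
      exact le_of_mul_le_mul_right key hs

end Abstract

/-! ### The pair tower of the Hubbard torus -/

section Torus

-- see `SoloBlindTwistAveraging`: synthesised vs landed `DecidableEq` instances on `Lex`
attribute [-instance] instDecidableEqLex

variable {L : ℕ} [NeZero L]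

/-- The `j`-th descending pair-tower state `Δ_g^j ψ` lies in the sector `(N − 2j, M)` when
`ψ ∈ (N, M)`. Scalapino, Phys. Rep. 250 (1995) 329, §2. [folklore] -/
theorem pairField_tower_mem_szSector (g : (Fin 2 → ℤ) → ℝ) {N : ℕ} {M : ℝ}
    {ψ : Fock (Orb (FermionTorus 2 L))} (hψ : ψ ∈ szSector N M) (j : ℕ) :
    ((pairField g L).mulVec)^[j] ψ ∈ szSector (N - 2 * j) M := by
  induction j with
  | zero => simpa using hψ
  | succ j ih =>
    rw [Function.iterate_succ_apply']
    have h := PairTower.pairField_mulVec_mem_szSector g ih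
    have hN : N - 2 * j - 2 = N - 2 * (j + 1) := by omega
    rw [hN] at h
    exact h

/-- **Theorem 31 (hereditary d-wave order along the pair tower).** If `ψ` has pair-field order
`a‖ψ‖² ≤ ‖Δ_gψ‖²` (`|g| ≤ 1`), then every descending tower state `ψ_j = Δ_g^j ψ` has
`(a − 800 j L²)‖ψ_j‖² ≤ ‖Δ_g ψ_j‖²`: order `≥ a − 800jL²` after normalisation, an `O(L²)` loss per
step against `a ≍ L⁴`. [this work] -/
theorem pairField_tower_order (g : (Fin 2 → ℤ) → ℝ) (hg : ∀ e, |g e| ≤ 1)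
    (ψ : Fock (Orb (FermionTorus 2 L))) {a : ℝ}
    (h0 : a * (star ψ ⬝ᵥ ψ).re ≤ (star (pairField g L *ᵥ ψ) ⬝ᵥ (pairField g L *ᵥ ψ)).re)
    (j : ℕ) :
    (a - j * (800 * (L : ℝ) ^ 2)) *
        (star (((pairField g L).mulVec)^[j] ψ) ⬝ᵥ (((pairField g L).mulVec)^[j] ψ)).re
      ≤ (star (pairField g L *ᵥ ((pairField g L).mulVec)^[j] ψ) ⬝ᵥ
          (pairField g L *ᵥ ((pairField g L).mulVec)^[j] ψ)).re :=
  order_descends_iterate (pairField g L) ψ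
    (PairTower.norm_commutator_pairField_conjTranspose_le g hg) h0 j

/-- One ascending step: `‖Δ_gᴴψ‖² ≥ ‖Δ_gψ‖² − 800L²‖ψ‖²` and `(‖Δ_gᴴψ‖²)² ≤ ‖Δ_g(Δ_gᴴψ)‖²‖ψ‖²`,
so the normalised state `Δ_gᴴψ ∈ (N + 2, M)` has order `≥ a − 800L²` when the unit vector `ψ`
has order `a`. [this work] -/
theorem pairField_conjTranspose_order (g : (Fin 2 → ℤ) → ℝ) (hg : ∀ e, |g e| ≤ 1)
    (ψ : Fock (Orb (FermionTorus 2 L))) :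
    (star (pairField g L *ᵥ ψ) ⬝ᵥ (pairField g L *ᵥ ψ)).re
        - 800 * (L : ℝ) ^ 2 * (star ψ ⬝ᵥ ψ).re
      ≤ (star ((pairField g L)ᴴ *ᵥ ψ) ⬝ᵥ ((pairField g L)ᴴ *ᵥ ψ)).re ∧
    (star ((pairField g L)ᴴ *ᵥ ψ) ⬝ᵥ ((pairField g L)ᴴ *ᵥ ψ)).re ^ 2
      ≤ (star (pairField g L *ᵥ ((pairField g L)ᴴ *ᵥ ψ)) ⬝ᵥ
          (pairField g L *ᵥ ((pairField g L)ᴴ *ᵥ ψ))).re * (star ψ ⬝ᵥ ψ).re := by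
  refine ⟨?_, order_ascends _ _⟩
  have h := re_self_conjTranspose_ge (pairField g L) ψ
  have hK := PairTower.norm_commutator_pairField_conjTranspose_le g hg (L := L)
  have hs := re_star_dotProduct_self_nonneg ψ
  nlinarith [mul_le_mul_of_nonneg_right hK hs]

/-- **The d-wave tower of the summit.** For a unit vector `ψ` in the summit's sector `(N, 0)`
with `d`-wave order `a ≤ re⟨ψ, Δ_dᴴΔ_d ψ⟩`, every tower state `Δ_d^j ψ` lies in `(N − 2j, 0)` and
has `(a − 800jL²)‖Δ_d^jψ‖² ≤ ‖Δ_d^{j+1}ψ‖²`. [this work] -/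
theorem dWave_tower_order {N : ℕ} (ψ : Fock (Orb (FermionTorus 2 L)))
    (hψ : ψ ∈ szSector N 0) (hψ1 : star ψ ⬝ᵥ ψ = 1) {a : ℝ}
    (ha : a ≤ (star (pairField dWaveFormFactor L *ᵥ ψ) ⬝ᵥ
      (pairField dWaveFormFactor L *ᵥ ψ)).re) (j : ℕ) :
    ((pairField dWaveFormFactor L).mulVec)^[j] ψ ∈ szSector (N - 2 * j) 0 ∧
    (a - j * (800 * (L : ℝ) ^ 2)) *
        (star (((pairField dWaveFormFactor L).mulVec)^[j] ψ) ⬝ᵥ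
          (((pairField dWaveFormFactor L).mulVec)^[j] ψ)).re
      ≤ (star (pairField dWaveFormFactor L *ᵥ ((pairField dWaveFormFactor L).mulVec)^[j] ψ) ⬝ᵥ
          (pairField dWaveFormFactor L *ᵥ ((pairField dWaveFormFactor L).mulVec)^[j] ψ)).re := by
  refine ⟨pairField_tower_mem_szSector dWaveFormFactor hψ j,
    pairField_tower_order dWaveFormFactor abs_dWaveFormFactor_le_one ψ ?_ j⟩
  rw [hψ1, Complex.one_re, mul_one]
  exact ha

end Torus

end TowerOrder

end Summit.HubbardSuperconductivity.HubbardSuperconductivity.Theorems
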